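import Literature.NumberTheory.Transcendental.KZTorusLogRep
import Literature.NumberTheory.Transcendental.KZLogCalculusProofs

/-!
# Jensen is scissors — toolkit II: three measure-theoretic lemmas along the last coordinate

Support file for item stmt-KontsevichZagierPeriods-5204 (`JensenIsScissors`, route
KontsevichZagierPeriods/K2SymbolChains). After the volume-preserving identification
`ℝᵐ⁺¹ ≃ ℝ × ℝᵐ` (`MeasurableEquiv.piFinSuccAbove _ (Fin.last m)`, inverse `(t, x) ↦ Fin.snoc x t`):

* `volume_eq_zero_of_fibre` — a measurable set all of whose fibres along the last coordinate are
  null is null (Tonelli);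
* `integrableOn_cyl_mul` — `f (init z) · g (z last)` is integrable on the cylinder `{init z ∈ B}`
  when `f` is integrable on `B` and `g` on `ℝ` (`Integrable.mul_prod`);
* `integrableOn_mul_log_of_logUnfold` — the converse of `KZ.integrableOn_logUnfoldIntegrand`
  (`KZTorusLogRep.lean`): if the signed unfolding `±h(x)/u` of `h · log V` is absolutely integrable
  on `{(x, u) | x ∈ τ, u between 1 and V x}` (`V > 0`), then `h · log V` is absolutely integrable on
  `τ` — by Tonelli, the fibre integral being exactly `|h x| · |log V x|`
  (`KZ.lintegral_enorm_logUnfoldIntegrand_fibre`).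

[Kontsevich–Zagier 2001, §1.1 ("introducing more variables")] [folklore]
-/

noncomputable section

open MeasureTheory Set
open Literature.NumberTheory.Transcendental Literature.ModelTheory.ExponentialFields

namespace Summit.KontsevichZagierPeriods.K2SymbolChains.JensenIsScissorsProof

open Literature.NumberTheory.Transcendental.KZ

variable {m : ℕ}

/-- **A measurable set with null fibres along the last coordinate is null** (Tonelli after
`ℝᵐ⁺¹ ≃ ℝ × ℝᵐ`). [folklore] -/
theorem volume_eq_zero_of_fibre {A : Set (Fin (m + 1) → ℝ)} (hA : MeasurableSet A)
    (h : ∀ x : Fin m → ℝ, volume {t : ℝ | (Fin.snoc x t : Fin (m + 1) → ℝ) ∈ A} = 0) :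
    volume A = 0 := by
  set e : (Fin (m + 1) → ℝ) ≃ᵐ ℝ × (Fin m → ℝ) :=
    MeasurableEquiv.piFinSuccAbove (fun _ => ℝ) (Fin.last m) with he_def
  have he : MeasurePreserving e volume volume :=
    volume_preserving_piFinSuccAbove (fun _ => ℝ) (Fin.last m)
  have he_symm : ∀ p : ℝ × (Fin m → ℝ), e.symm p = Fin.snoc p.2 p.1 := fun p => by
    simp [he_def, MeasurableEquiv.piFinSuccAbove, Fin.snocEquiv]
  have hA' : MeasurableSet (e.symm ⁻¹' A) := e.symm.measurable hA
  calc volume A = volume (e.symm ⁻¹' A) :=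
        ((he.symm e).measure_preimage hA.nullMeasurableSet).symm
    _ = (volume : Measure ℝ).prod (volume : Measure (Fin m → ℝ)) (e.symm ⁻¹' A) := by
        rw [Measure.volume_eq_prod]
    _ = ∫⁻ y, volume ((fun t : ℝ => (t, y)) ⁻¹' (e.symm ⁻¹' A)) := Measure.prod_apply_symm hA'
    _ = ∫⁻ _ : Fin m → ℝ, (0 : ENNReal) := by
        refine lintegral_congr fun y => ?_
        have : (fun t : ℝ => (t, y)) ⁻¹' (e.symm ⁻¹' A) = {t : ℝ | (Fin.snoc y t : Fin (m + 1) → ℝ) ∈ A} := by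
          ext t
          simp [he_symm]
        rw [this, h y]
    _ = 0 := lintegral_zero

/-- A `ℚ`-semialgebraic subset of `ℝᵐ⁺¹` all of whose fibres along the last coordinate are finite
is null. [folklore] -/
theorem volume_eq_zero_of_fibre_finite {A : Set (Fin (m + 1) → ℝ)} (hA : IsSemialgebraic ℚ A)
    (h : ∀ x : Fin m → ℝ, Set.Finite {t : ℝ | (Fin.snoc x t : Fin (m + 1) → ℝ) ∈ A}) :
    volume A = 0 :=
  volume_eq_zero_of_fibre (IsSemialgebraic.measurableSet_holds hA) fun x => (h x).measure_zero _

/-- **Products are integrable on cylinders**: if `f` is integrable on `B ⊆ ℝᵐ` and `g` on `ℝ`, then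
`z ↦ f (init z) · g (z last)` is integrable on the cylinder `{z | init z ∈ B} ⊆ ℝᵐ⁺¹`.
[folklore] -/
theorem integrableOn_cyl_mul {B : Set (Fin m → ℝ)} {f : (Fin m → ℝ) → ℝ}
    {g : ℝ → ℝ} (hf : IntegrableOn f B) (hg : Integrable g) :
    IntegrableOn (fun z : Fin (m + 1) → ℝ => f (Fin.init z) * g (z (Fin.last m)))
      {z | Fin.init z ∈ B} := by
  set e : (Fin (m + 1) → ℝ) ≃ᵐ ℝ × (Fin m → ℝ) :=
    MeasurableEquiv.piFinSuccAbove (fun _ => ℝ) (Fin.last m) with he_def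
  have he : MeasurePreserving e volume volume :=
    volume_preserving_piFinSuccAbove (fun _ => ℝ) (Fin.last m)
  have he_symm : ∀ p : ℝ × (Fin m → ℝ), e.symm p = Fin.snoc p.2 p.1 := fun p => by
    simp [he_def, MeasurableEquiv.piFinSuccAbove, Fin.snocEquiv]
  have hprod : Integrable (fun p : ℝ × (Fin m → ℝ) => g p.1 * f p.2)
      ((volume : Measure ℝ).prod (volume.restrict B)) := hg.mul_prod hf
  have h1 : IntegrableOn (fun p : ℝ × (Fin m → ℝ) => g p.1 * f p.2) (univ ×ˢ B)
      ((volume : Measure ℝ).prod (volume : Measure (Fin m → ℝ))) := by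
    rw [IntegrableOn, ← Measure.prod_restrict, Measure.restrict_univ]
    exact hprod
  have hpre : e.symm ⁻¹' {z : Fin (m + 1) → ℝ | Fin.init z ∈ B} = univ ×ˢ B := by
    ext p
    simp [he_symm]
  have hcomp : (fun z : Fin (m + 1) → ℝ => f (Fin.init z) * g (z (Fin.last m))) ∘ e.symm =
      fun p => g p.1 * f p.2 := by
    ext p
    simp [he_symm, mul_comm]
  have key : IntegrableOn
      ((fun z : Fin (m + 1) → ℝ => f (Fin.init z) * g (z (Fin.last m))) ∘ e.symm)
      (e.symm ⁻¹' {z | Fin.init z ∈ B}) := by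
    rw [hpre, hcomp, Measure.volume_eq_prod]
    exact h1
  exact ((he.symm e).integrableOn_comp_preimage e.symm.measurableEmbedding).mp key

/-- **Converse Tonelli for the signed unfolding.** If `h`, `V` are `ℚ`-semialgebraic on the
`ℚ`-semialgebraic base `τ`, `V > 0` on `τ`, and the signed unfolding integrand `±h(x)/u` is
absolutely integrable on `{(x, u) | x ∈ τ, u between 1 and V x}`, then `h · log V` is absolutely
integrable on `τ` (the fibre integral of `|h(x)/u|` is `|h x| |log V x|`).
[Kontsevich–Zagier 2001, §1.1] [folklore] -/
theorem integrableOn_mul_log_of_logUnfold {τ : Set (Fin m → ℝ)} {V h : (Fin m → ℝ) → ℝ}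
    (hτ : IsSemialgebraic ℚ τ) (hh : IsSemialgebraicFunOn ℚ τ h) (hV : IsSemialgebraicFunOn ℚ τ V)
    (hV0 : ∀ x ∈ τ, 0 < V x)
    (hint : IntegrableOn (logUnfoldIntegrand h) (logUnfoldDomain τ V)) :
    IntegrableOn (fun x => h x * Real.log (V x)) τ := by
  have hτm : MeasurableSet τ := IsSemialgebraic.measurableSet_holds hτ
  have hDm : MeasurableSet (logUnfoldDomain τ V) :=
    IsSemialgebraic.measurableSet_holds (isSemialgebraic_logUnfoldDomain hV)
  -- measurability of `h log V` on `τ`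
  have hmeas : AEStronglyMeasurable (fun x => h x * Real.log (V x)) (volume.restrict τ) :=
    (aestronglyMeasurable_of_isSemialgebraicFunOn hh hτm).mul
      (Real.measurable_log.comp_aemeasurable
        (aestronglyMeasurable_of_isSemialgebraicFunOn hV hτm).aemeasurable).aestronglyMeasurable
  refine ⟨hmeas, ?_⟩
  -- a measurable modification of the integrand and its indicator
  set F₀ : (Fin (m + 1) → ℝ) → ℝ := logUnfoldIntegrand (τ.indicator h) with hF₀_def
  have hF₀m : Measurable F₀ := measurable_logUnfoldIntegrand_indicator hτm hh
  have hF₀D : EqOn F₀ (logUnfoldIntegrand h) (logUnfoldDomain τ V) := fun w hw => by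
    simp only [hF₀_def, logUnfoldIntegrand, indicator_of_mem hw.1]
  set G : (Fin (m + 1) → ℝ) → ENNReal := (logUnfoldDomain τ V).indicator fun z => ‖F₀ z‖ₑ
    with hG_def
  have hGm : Measurable G := (hF₀m.enorm).indicator hDm
  have hGfin : ∫⁻ z, G z < ⊤ := by
    rw [hG_def, lintegral_indicator hDm,
      setLIntegral_congr_fun hDm (fun z hz => by rw [hF₀D hz])]
    exact hint.2
  set e : (Fin (m + 1) → ℝ) ≃ᵐ ℝ × (Fin m → ℝ) :=
    MeasurableEquiv.piFinSuccAbove (fun _ => ℝ) (Fin.last m) with he_def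
  have he : MeasurePreserving e volume volume :=
    volume_preserving_piFinSuccAbove (fun _ => ℝ) (Fin.last m)
  have he_symm : ∀ p : ℝ × (Fin m → ℝ), e.symm p = Fin.snoc p.2 p.1 := fun p => by
    simp [he_def, MeasurableEquiv.piFinSuccAbove, Fin.snocEquiv]
  -- the fibre integrals of `G`
  have hfib : ∀ x ∈ τ, ∫⁻ t, G (Fin.snoc x t) = ‖h x * Real.log (V x)‖ₑ := by
    intro x hx
    have hVx := hV0 x hx
    set I : Set ℝ := {t | (1 < t ∧ t < V x) ∨ (V x < t ∧ t < 1)} with hI_def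
    have hIm : MeasurableSet I :=
      ((measurableSet_Ioi.inter measurableSet_Iio).union (measurableSet_Ioi.inter measurableSet_Iio))
    have hGx : (fun t => G (Fin.snoc x t)) = I.indicator fun t => ‖logUnfoldIntegrand h (Fin.snoc x t)‖ₑ := by
      ext t
      by_cases ht : t ∈ I
      · have hmem : (Fin.snoc x t : Fin (m + 1) → ℝ) ∈ logUnfoldDomain τ V :=
          snoc_mem_logUnfoldDomain.2 ⟨hx, ht⟩
        rw [indicator_of_mem ht, hG_def, indicator_of_mem hmem, hF₀D hmem]
      · rw [indicator_of_notMem ht, hG_def, indicator_of_notMem]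
        exact fun hm => ht (snoc_mem_logUnfoldDomain.1 hm).2
    have hIJ : I =ᵐ[volume] Icc (min 1 (V x)) (max 1 (V x)) := by
      have hsub : I ⊆ Icc (min 1 (V x)) (max 1 (V x)) := by
        rintro t (⟨h1, h2⟩ | ⟨h1, h2⟩)
        · exact ⟨(min_le_left _ _).trans h1.le, h2.le.trans (le_max_right _ _)⟩
        · exact ⟨(min_le_right _ _).trans h1.le, h2.le.trans (le_max_left _ _)⟩
      have hdiff : Icc (min 1 (V x)) (max 1 (V x)) \ I ⊆ {1, V x} := by
        intro t ht
        rcases ht with ⟨⟨h1, h2⟩, hn⟩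
        simp only [hI_def, mem_setOf_eq, not_or, not_and, not_lt] at hn
        simp only [mem_insert_iff, mem_singleton_iff]
        by_contra hcon
        simp only [not_or] at hcon
        rcases le_total 1 (V x) with hle | hle
        · rw [min_eq_left hle] at h1
          rw [max_eq_right hle] at h2
          have := hn.1 (lt_of_le_of_ne h1 (Ne.symm hcon.1))
          exact hcon.2 (le_antisymm h2 this)
        · rw [min_eq_right hle] at h1
          rw [max_eq_left hle] at h2
          have := hn.2 (lt_of_le_of_ne h1 (Ne.symm hcon.2))
          exact hcon.1 (le_antisymm h2 this)
      refine (ae_eq_set).2 ⟨?_, ?_⟩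
      · rw [sdiff_eq_empty.2 hsub]; exact measure_empty
      · exact measure_mono_null hdiff ((Set.toFinite _).measure_zero _)
    rw [hGx, lintegral_indicator hIm, setLIntegral_congr hIJ]
    exact lintegral_enorm_logUnfoldIntegrand_fibre h V hVx
  have hfib_out : ∀ x ∉ τ, (fun t => G (Fin.snoc x t)) = fun _ => 0 := by
    intro x hx
    ext t
    rw [hG_def, indicator_of_notMem]
    exact fun hm => hx (snoc_mem_logUnfoldDomain.1 hm).1
  have hmeas' : AEMeasurable (fun p : ℝ × (Fin m → ℝ) => G (e.symm p))
      ((volume : Measure ℝ).prod (volume : Measure (Fin m → ℝ))) := by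
    rw [← Measure.volume_eq_prod]
    exact (hGm.comp e.symm.measurable).aemeasurable
  unfold HasFiniteIntegral
  calc ∫⁻ x in τ, ‖h x * Real.log (V x)‖ₑ
      = ∫⁻ x, τ.indicator (fun x => ‖h x * Real.log (V x)‖ₑ) x := (lintegral_indicator hτm _).symm
    _ = ∫⁻ x, ∫⁻ t, G (e.symm (t, x)) := by
        refine lintegral_congr fun x => ?_
        simp_rw [he_symm]
        by_cases hx : x ∈ τ
        · rw [indicator_of_mem hx, hfib x hx]
        · rw [indicator_of_notMem hx, hfib_out x hx]
          simp
    _ = ∫⁻ p, G (e.symm p) ∂((volume : Measure ℝ).prod (volume : Measure (Fin m → ℝ))) :=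
        (lintegral_prod_symm _ hmeas').symm
    _ = ∫⁻ p, G (e.symm p) := by rw [Measure.volume_eq_prod]
    _ = ∫⁻ z, G z := (he.symm e).lintegral_comp_emb e.symm.measurableEmbedding _
    _ < ⊤ := hGfin

end Summit.KontsevichZagierPeriods.K2SymbolChains.JensenIsScissorsProof
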